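import Literature.Topology.FourManifolds.FishtailParams
import Literature.Topology.FourManifolds.FishtailRealLemmas
import HarnessLib

/-!
# Facts about the concrete fishtail parameters: angles on the slabs, profile plateaus

Infrastructure for the explicit fishtail neighbourhood (R. Gompf, *More Cappell–Shaneson spheres
are standard*, Algebr. Geom. Topol. 10 (2010), proof of Thm 2.1 and Lemma 2.2; the named fact
`Literature.Topology.FourManifolds.gompf2010_framedTwist`). For the parameters of
`FishtailParams.lean`: the ranges of the master angles `α = angleUp r₀`, `β = angleDown r₁`
on the glue slabs and windows; the plateaus of the profiles `kap`, `muN`, `muS`, `muL` and of the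
vertical profile; the latitude thresholds `n₀(‖d‖)`; and the plateau structures `D0NPlateau`,
`D0APlateau` of the concrete tube data `fishT`.

Everything is proved; no named facts.

## References

* R. E. Gompf, *More Cappell–Shaneson spheres are standard*, Algebr. Geom. Topol. 10 (2010)
  1665–1681, proof of Thm 2.1 and Lemma 2.2. [GompfAGT2010]
-/

noncomputable section

open scoped Real Topology ContDiff
open Set Real

namespace Literature.Topology.FourManifolds

namespace FP

variable (ε : ℝ)

/-! ### Numeric facts about `√3` and the radii -/

/-- `17/10 < √3 < 7/4` and `4/7 < 1/√3 < 3/5`. [folklore] -/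
theorem sqrt_three_bounds : 17 / 10 < Real.sqrt 3 ∧ Real.sqrt 3 < 7 / 4 := by
  constructor
  · rw [Real.lt_sqrt (by norm_num)]; norm_num
  · rw [Real.sqrt_lt' (by norm_num)]; norm_num

/-- Bounds for `1/√3`. [folklore] -/
theorem inv_sqrt_three_bounds : 4 / 7 < 1 / Real.sqrt 3 ∧ 1 / Real.sqrt 3 < 3 / 5 := by
  obtain ⟨h1, h2⟩ := sqrt_three_bounds
  have h0 : 0 < Real.sqrt 3 := by linarith
  constructor
  · rw [lt_div_iff₀ h0]; linarith
  · rw [div_lt_iff₀ h0]; linarith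

variable {ε}

/-- `η ≤ 1/9680 < 1/100` (for `ε ≤ 1/2`). [folklore] -/
theorem eta_lt (hε : 0 < ε) (hε2 : ε ≤ 1 / 2) : eta ε < 1 / 100 := by linarith [eta_le ε hε]

/-! ### The master angle `α` on the slabs and windows -/

/-- **Slab 3** (`|r - s₃| < 1/10`): `-π/4 < α < 0`. [folklore] -/
theorem alpha_slab3 {r : ℝ} (h : |r - s3 ε| < 1 / 10) : -(π / 4) < angleUp (rzero ε) r ∧ angleUp (rzero ε) r < 0 := by
  obtain ⟨h1, h2⟩ := abs_lt.1 h
  obtain ⟨hs1, hs2⟩ := sqrt_three_bounds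
  obtain ⟨hi1, hi2⟩ := inv_sqrt_three_bounds
  unfold s3 at h1 h2
  constructor
  · rw [← angleUp_sub_sqrt_three (rzero ε)]
    exact strictMono_angleUp _ (by linarith)
  · rw [← angleUp_sub_inv_sqrt_three (rzero ε)]
    exact strictMono_angleUp _ (by linarith)

/-- **Window U5** (`s₃ - 1/10 < r < s₄ + 1/10`): `-π/4 < α < 3π/4`. [folklore] -/
theorem alpha_winU5 {r : ℝ} (h1 : s3 ε - 1 / 10 < r) (h2 : r < s4 ε + 1 / 10) :
    -(π / 4) < angleUp (rzero ε) r ∧ angleUp (rzero ε) r < 3 * π / 4 := by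
  obtain ⟨hs1, hs2⟩ := sqrt_three_bounds
  obtain ⟨hi1, hi2⟩ := inv_sqrt_three_bounds
  unfold s3 at h1; unfold s4 at h2
  constructor
  · rw [← angleUp_sub_sqrt_three (rzero ε)]
    exact strictMono_angleUp _ (by linarith)
  · rw [← angleUp_add_sqrt_three (rzero ε)]
    exact strictMono_angleUp _ (by linarith)

/-- **Slab 4** (`|r - s₄| < 1/10`): `π/2 < α < 3π/4`. [folklore] -/
theorem alpha_slab4 {r : ℝ} (h : |r - s4 ε| < 1 / 10) : π / 2 < angleUp (rzero ε) r ∧ angleUp (rzero ε) r < 3 * π / 4 := by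
  obtain ⟨h1, h2⟩ := abs_lt.1 h
  obtain ⟨hs1, hs2⟩ := sqrt_three_bounds
  obtain ⟨hi1, hi2⟩ := inv_sqrt_three_bounds
  unfold s4 at h1 h2
  constructor
  · rw [← angleUp_add_inv_sqrt_three (rzero ε)]
    exact strictMono_angleUp _ (by linarith)
  · rw [← angleUp_add_sqrt_three (rzero ε)]
    exact strictMono_angleUp _ (by linarith)

/-- Beyond `s₄ - 1/10`: `π/2 < α` (and always `α < π`). [folklore] -/
theorem alpha_gt_pi_div_two {r : ℝ} (h1 : s4 ε - 1 / 10 < r) : π / 2 < angleUp (rzero ε) r := by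
  obtain ⟨hs1, hs2⟩ := sqrt_three_bounds
  obtain ⟨hi1, hi2⟩ := inv_sqrt_three_bounds
  unfold s4 at h1
  rw [← angleUp_add_inv_sqrt_three (rzero ε)]
  exact strictMono_angleUp _ (by linarith)

/-- `3π/4 < α ↔ r₀ + √3 < r`. [folklore] -/
theorem three_pi_div_four_lt_alpha_iff {r : ℝ} : 3 * π / 4 < angleUp (rzero ε) r ↔ rzero ε + Real.sqrt 3 < r := by
  rw [← angleUp_add_sqrt_three (rzero ε)]
  exact (strictMono_angleUp _).lt_iff_lt

/-- **Slab 5** (`|r - s₅| < 1/10`): `π - arctan (1/3) ≤ α` and `α ≤ π - 1/5`. [folklore] -/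
theorem alpha_slab5 {r : ℝ} (h : |r - s5 ε| < 1 / 10) :
    π - arctan (1 / 3) ≤ angleUp (rzero ε) r ∧ angleUp (rzero ε) r ≤ π - 1 / 5 := by
  obtain ⟨h1, h2⟩ := abs_lt.1 h
  unfold s5 at h1 h2
  set x := r - rzero ε with hx
  have hx1 : 59 / 10 < x := by linarith
  have hx2 : x < 61 / 10 := by linarith
  have hr : r = rzero ε + x := by rw [hx]; ring
  have hx0 : 0 < x := by linarith
  have hu1 : 10 / 61 < x⁻¹ := by rw [inv_eq_one_div, lt_div_iff₀ hx0]; linarith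
  have hu2 : x⁻¹ < 10 / 59 := by rw [inv_eq_one_div, div_lt_iff₀ hx0]; linarith
  rw [hr, angleUp_eq_pi_sub _ hx0]
  constructor
  · -- `(3/2) arctan (1/x) ≤ arctan (1/3)` since `arctan (1/x) ≤ 1/x < 10/59` and `arctan (1/3) ≥ 3/10`
    have h3 : 3 / 10 ≤ arctan (1 / 3) := by
      have := div_one_add_sq_le_arctan (x := 1 / 3) (by norm_num)
      norm_num at this ⊢; linarith
    have h4 : arctan x⁻¹ ≤ x⁻¹ := IwaseTori.arctan_le_self (inv_pos.2 hx0).le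
    linarith
  · -- `(3/2) arctan (1/x) ≥ (3/2) (1/x)/(1 + 1/x²) ≥ 1/5`
    have h4 : x⁻¹ / (1 + x⁻¹ ^ 2) ≤ arctan x⁻¹ := div_one_add_sq_le_arctan (inv_pos.2 hx0).le
    have h5 : 2 / 15 ≤ x⁻¹ / (1 + x⁻¹ ^ 2) := by
      rw [le_div_iff₀ (by positivity)]
      nlinarith
    linarith

/-- **On `[a₆, b₆] ⊂ [r₀ + 9, r₀ + 13]`**: `footY ρ_A α ≤ 1/2`. [folklore] -/
theorem footY_alpha_le_half {r : ℝ} (h1 : rzero ε + 9 ≤ r) (h2 : r ≤ rzero ε + 13) :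
    footY ρA (angleUp (rzero ε) r) ≤ 1 / 2 := by
  set x := r - rzero ε with hx
  have hx1 : 9 ≤ x := by linarith
  have hx2 : x ≤ 13 := by linarith
  have hr : r = rzero ε + x := by rw [hx]; ring
  have hx0 : 0 < x := by linarith
  have hu1 : 1 / 13 ≤ x⁻¹ := by rw [inv_eq_one_div, le_div_iff₀ hx0]; linarith
  have hu2 : x⁻¹ ≤ 1 / 9 := by rw [inv_eq_one_div, div_le_iff₀ hx0]; linarith
  rw [hr, angleUp_eq_pi_sub _ hx0]
  -- `y = (3/2) arctan (1/x) ≥ 1/9`, so `footY ≤ ρ_A (1 + 9) = 1/2`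
  have hy : 1 / 9 ≤ 3 / 2 * arctan x⁻¹ := by
    have h4 : x⁻¹ / (1 + x⁻¹ ^ 2) ≤ arctan x⁻¹ := div_one_add_sq_le_arctan (inv_pos.2 hx0).le
    have h5 : 2 / 27 ≤ x⁻¹ / (1 + x⁻¹ ^ 2) := by
      rw [le_div_iff₀ (by positivity)]
      nlinarith
    linarith
  have hy2 : 3 / 2 * arctan x⁻¹ < π / 2 := by
    have h4 : arctan x⁻¹ ≤ x⁻¹ := IwaseTori.arctan_le_self (inv_pos.2 hx0).le
    linarith [pi_gt_three]
  have hα0 : 0 < π - 3 / 2 * arctan x⁻¹ := by linarith [pi_gt_three]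
  have h := footY_le_of_le_pi_sub ρA_pos hα0 le_rfl (by norm_num : (0:ℝ) < 1 / 9) hy hy2
  unfold ρA at h ⊢
  linarith

/-! ### The master angle `β` on the slabs and windows -/

/-- **Slab 6** (`|r - s₆| < 1/10`): `3π/4 < β < π`, and `footY R₀ β ≤ 3/5`. [folklore] -/
theorem beta_slab6 {r : ℝ} (h : |r - s6 ε| < 1 / 10) :
    3 * π / 4 < angleDown (rone ε) r ∧ angleDown (rone ε) r < π ∧ footY R0 (angleDown (rone ε) r) ≤ 3 / 5 := by
  obtain ⟨h1, h2⟩ := abs_lt.1 h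
  obtain ⟨hs1, hs2⟩ := sqrt_three_bounds
  unfold s6 at h1 h2
  have hβ1 : 3 * π / 4 < angleDown (rone ε) r := by
    rw [← angleDown_sub_sqrt_three (rone ε)]
    exact strictAnti_angleDown _ (by linarith)
  have hβ2 := (angleDown_mem (rone ε) r).2
  refine ⟨hβ1, hβ2, ?_⟩
  set x := rone ε - r with hx
  have hx1 : 21 / 10 < x := by linarith
  have hx2 : x < 47 / 20 := by linarith
  have hx0 : 0 < x := by linarith
  have hu1 : 20 / 47 < x⁻¹ := by rw [inv_eq_one_div, lt_div_iff₀ hx0]; linarith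
  have hu2 : x⁻¹ < 10 / 21 := by rw [inv_eq_one_div, div_lt_iff₀ hx0]; linarith
  have hr : r = rone ε - x := by rw [hx]; ring
  rw [hr, angleDown_eq_pi_sub _ hx0]
  have hy : 1 / 2 ≤ 3 / 2 * arctan x⁻¹ := by
    have h4 : x⁻¹ / (1 + x⁻¹ ^ 2) ≤ arctan x⁻¹ := div_one_add_sq_le_arctan (inv_pos.2 hx0).le
    have h5 : 1 / 3 ≤ x⁻¹ / (1 + x⁻¹ ^ 2) := by
      rw [le_div_iff₀ (by positivity)]
      nlinarith
    linarith
  have hy2 : 3 / 2 * arctan x⁻¹ < π / 2 := by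
    have h4 : arctan x⁻¹ ≤ x⁻¹ := IwaseTori.arctan_le_self (inv_pos.2 hx0).le
    linarith [pi_gt_three]
  have hα0 : 0 < π - 3 / 2 * arctan x⁻¹ := by linarith [pi_gt_three]
  have h := footY_le_of_le_pi_sub R0_pos hα0 le_rfl (by norm_num : (0:ℝ) < 1 / 2) hy hy2
  unfold R0 at h ⊢
  linarith

/-- **Window U2** (`s₆ - 1/10 < r < s₇ + 1/10`): `-π/4 < β ≤ π - arctan (1/3)`. [folklore] -/
theorem beta_winU2 {r : ℝ} (h1 : s6 ε - 1 / 10 < r) (h2 : r < s7 ε + 1 / 10) :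
    -(π / 4) < angleDown (rone ε) r ∧ angleDown (rone ε) r ≤ π - arctan (1 / 3) := by
  obtain ⟨hs1, hs2⟩ := sqrt_three_bounds
  obtain ⟨hi1, hi2⟩ := inv_sqrt_three_bounds
  unfold s6 at h1; unfold s7 at h2
  constructor
  · rw [← angleDown_add_sqrt_three (rone ε)]
    exact strictAnti_angleDown _ (by linarith)
  · -- `β ≤ β(r₁ - x)` with `x = r₁ - (s₆ - 1/10) < 5/2`, and `(3/2) arctan(1/x) ≥ arctan(1/3)`
    have hle : angleDown (rone ε) r ≤ angleDown (rone ε) (rone ε - 5 / 2) :=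
      (strictAnti_angleDown _).antitone (by linarith)
    refine hle.trans ?_
    rw [angleDown_eq_pi_sub _ (by norm_num), show ((5 : ℝ) / 2)⁻¹ = 2 / 5 by norm_num]
    have h3 : arctan (1 / 3) ≤ 1 / 3 := IwaseTori.arctan_le_self (by norm_num)
    have h4 : (2 / 5 : ℝ) / (1 + (2 / 5 : ℝ) ^ 2) ≤ arctan (2 / 5 : ℝ) := div_one_add_sq_le_arctan (by norm_num)
    norm_num at h4
    linarith

/-- `-1/20 ≤ β₇ < 0`. [folklore] -/
theorem beta7_ge : -(1 / 20) ≤ beta7 ε := by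
  unfold beta7 s7 angleDown
  rw [show rone ε + 1 / Real.sqrt 3 + 3 / 100 - rone ε = 1 / Real.sqrt 3 + 3 / 100 by ring]
  have h := arctan_sub_arctan_le (x := 1 / Real.sqrt 3) (y := 1 / Real.sqrt 3 + 3 / 100) (by positivity) (by linarith)
  rw [show (1 : ℝ) / Real.sqrt 3 = (Real.sqrt 3)⁻¹ by rw [one_div], arctan_inv_sqrt_three] at h
  have : arctan ((Real.sqrt 3)⁻¹ + 3 / 100) ≤ π / 6 + 3 / 100 := by linarith
  rw [show (1 : ℝ) / Real.sqrt 3 = (Real.sqrt 3)⁻¹ by rw [one_div]]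
  linarith

/-- **Slab 7** (`|r - s₇| ≤ 3/100`): `-1/10 ≤ β ≤ 0`. [folklore] -/
theorem beta_slab7 {r : ℝ} (h : |r - s7 ε| ≤ 3 / 100) : -(1 / 10) ≤ angleDown (rone ε) r ∧ angleDown (rone ε) r ≤ 0 := by
  obtain ⟨h1, h2⟩ := abs_le.1 h
  constructor
  · -- `β ≥ β(s₇ + 3/100) ≥ π/4 - (3/2)(π/6 + 6/100)`
    have hle : angleDown (rone ε) (s7 ε + 3 / 100) ≤ angleDown (rone ε) r :=
      (strictAnti_angleDown _).antitone (by linarith)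
    refine le_trans ?_ hle
    unfold s7 angleDown
    rw [show rone ε + 1 / Real.sqrt 3 + 3 / 100 + 3 / 100 - rone ε = 1 / Real.sqrt 3 + 6 / 100 by ring]
    have h := arctan_sub_arctan_le (x := 1 / Real.sqrt 3) (y := 1 / Real.sqrt 3 + 6 / 100) (by positivity) (by linarith)
    rw [show (1 : ℝ) / Real.sqrt 3 = (Real.sqrt 3)⁻¹ by rw [one_div], arctan_inv_sqrt_three] at h
    rw [show (1 : ℝ) / Real.sqrt 3 = (Real.sqrt 3)⁻¹ by rw [one_div]]
    linarith [pi_lt_d2]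
  · rw [← angleDown_add_inv_sqrt_three (rone ε)]
    refine (strictAnti_angleDown _).antitone ?_
    unfold s7 at h1; linarith

/-- On slab 7 both `β` and `β₇` lie in `[-1/10, 0]`, so `cos ≥ 199/200`. [folklore] -/
theorem cos_beta_ge {r : ℝ} (h : |r - s7 ε| ≤ 3 / 100) : 199 / 200 ≤ cos (angleDown (rone ε) r) := by
  obtain ⟨h1, h2⟩ := beta_slab7 h
  exact cos_ge_of_abs_le (abs_le.2 ⟨by linarith, by linarith⟩)

/-- **`|tan β(r) - tan β₇| ≤ (38/25) |r - s₇|` on slab 7.** [folklore] -/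
theorem abs_tan_beta_sub_le {r : ℝ} (h : |r - s7 ε| ≤ 3 / 100) :
    |tan (angleDown (rone ε) r) - tan (beta7 ε)| ≤ 38 / 25 * |r - s7 ε| := by
  have hc1 := cos_beta_ge h
  have hc7 : 199 / 200 ≤ cos (beta7 ε) := cos_beta_ge (r := s7 ε) (by rw [sub_self, abs_zero]; norm_num)
  have h1 := abs_tan_sub_tan_le (by linarith) (by linarith) (a := angleDown (rone ε) r) (b := beta7 ε)
  have h2 : |angleDown (rone ε) r - beta7 ε| ≤ 3 / 2 * |r - s7 ε| := abs_angleDown_sub_le _ _ _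
  have hprod : (199 / 200) ^ 2 ≤ cos (angleDown (rone ε) r) * cos (beta7 ε) := by nlinarith
  calc |tan (angleDown (rone ε) r) - tan (beta7 ε)| ≤ |angleDown (rone ε) r - beta7 ε| / (cos (angleDown (rone ε) r) * cos (beta7 ε)) := h1
    _ ≤ (3 / 2 * |r - s7 ε|) / (199 / 200) ^ 2 := by
        exact div_le_div₀ (by positivity) h2 (by positivity) hprod
    _ ≤ 38 / 25 * |r - s7 ε| := by
        rw [div_le_iff₀ (by positivity)]
        nlinarith [abs_nonneg (r - s7 ε)]

/-- `-1/19 ≤ tan β₇ < 0`. [folklore] -/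
theorem tan_beta7_ge : -(1 / 19) ≤ tan (beta7 ε) := by
  have h0 := beta7_ge (ε := ε)
  have h1 := (beta7_bounds ε).2
  have hc : 199 / 200 ≤ cos (beta7 ε) := cos_ge_of_abs_le (abs_le.2 ⟨by linarith, by linarith⟩)
  -- `tan β₇ = sin β₇ / cos β₇ ≥ β₇ / cos β₇ ≥ -(1/20)/(199/200)`
  rw [tan_eq_sin_div_cos, le_div_iff₀ (by linarith)]
  have hs : beta7 ε ≤ sin (beta7 ε) := by
    have := Real.sin_le (x := -beta7 ε) (by linarith)
    rw [sin_neg] at this; linarith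
  nlinarith

/-! ### Profile plateaus -/

/-- `kap ε n = n`. [folklore] -/
theorem kap_of_le {n : ℝ} (hε : 0 < ε) (h : n ≤ 47 * ε / 100) : kap ε n = n := by
  rw [kap, blendFun_of_zero (stdBlend_of_le (by linarith) h)]

/-- `kap ε n = lam ε`. [folklore] -/
theorem kap_of_ge {n : ℝ} (hε : 0 < ε) (h : 52 * ε / 100 ≤ n) : kap ε n = lam ε := by
  rw [kap, blendFun_of_one (stdBlend_of_ge (by linarith) h)]

/-- `min n λ ≤ kap n ≤ max n λ`. [folklore] -/
theorem kap_mem (n : ℝ) : min n (lam ε) ≤ kap ε n ∧ kap ε n ≤ max n (lam ε) := by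
  have h := stdBlend_mem (47 * ε / 100) (52 * ε / 100) n
  rw [kap, blendFun]
  constructor
  · have h1 := min_le_left n (lam ε); have h2 := min_le_right n (lam ε)
    nlinarith
  · have h1 := le_max_left n (lam ε); have h2 := le_max_right n (lam ε)
    nlinarith

/-- `ContDiff ℝ ∞ (kap ε)`. [folklore] -/
theorem contDiff_kap : ContDiff ℝ ∞ (kap ε) := by
  unfold kap
  exact contDiff_blendFun (contDiff_stdBlend _ _) contDiff_id contDiff_const

/-- `muN ε n = 0`. [folklore] -/
theorem muN_of_le {n : ℝ} (hε : 0 < ε) (h : n ≤ 113 * ε / 200) : muN ε n = 0 := stdBlend_of_le (by linarith) h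
/-- `muN ε n = 1`. [folklore] -/
theorem muN_of_ge {n : ℝ} (hε : 0 < ε) (h : 121 * ε / 200 ≤ n) : muN ε n = 1 := stdBlend_of_ge (by linarith) h
/-- `muS ε n = 0`. [folklore] -/
theorem muS_of_le {n : ℝ} (hε : 0 < ε) (h : n ≤ 7 * ε / 10) : muS ε n = 0 := stdBlend_of_le (by linarith) h
/-- `muS ε n = 1`. [folklore] -/
theorem muS_of_ge {n : ℝ} (hε : 0 < ε) (h : 43 * ε / 50 ≤ n) : muS ε n = 1 := stdBlend_of_ge (by linarith) h
/-- `muL ε r = 0`. [folklore] -/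
theorem muL_of_le {r : ℝ} (h : r ≤ s7 ε + 1 / 25) : muL ε r = 0 := stdBlend_of_le (by linarith) h
/-- `muL ε r = 1`. [folklore] -/
theorem muL_of_ge {r : ℝ} (h : s7 ε + 7 / 100 ≤ r) : muL ε r = 1 := stdBlend_of_ge (by linarith) h

/-- `|(stdBlend a b)'| ≤ C₀ / (b - a)`. [folklore] -/
theorem abs_deriv_stdBlend_le {a b : ℝ} (hab : a < b) (r : ℝ) : |deriv (stdBlend a b) r| ≤ C0 / (b - a) := by
  have hpos : 0 < 1 / (b - a) := one_div_pos.2 (by linarith)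
  rw [(hasDerivAt_stdBlend a b r).deriv, abs_mul, abs_of_pos hpos]
  have h := norm_deriv_le_C0 ((r - a) / (b - a))
  rw [Real.norm_eq_abs] at h
  calc |deriv Real.smoothTransition ((r - a) / (b - a))| * (1 / (b - a)) ≤ C0 * (1 / (b - a)) :=
        mul_le_mul_of_nonneg_right h hpos.le
    _ = C0 / (b - a) := by ring

/-! ### The vertical profile plateaus -/

section Vert

variable (hε : 0 < ε) (hε2 : ε ≤ 1 / 2)

/-- `(vert ε hε hε2).m y = 1`. [folklore] -/
theorem vert_m_of_le {y : ℝ} (h : y ≤ 1) : (vert ε hε hε2).m y = 1 := by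
  show 1 - stdBlend 1 (6 / 5) y = 1
  rw [stdBlend_of_le (by norm_num) h]; ring

/-- `(vert ε hε hε2).m y = 0`. [folklore] -/
theorem vert_m_of_ge {y : ℝ} (h : 6 / 5 ≤ y) : (vert ε hε hε2).m y = 0 := by
  show 1 - stdBlend 1 (6 / 5) y = 0
  rw [stdBlend_of_ge (by norm_num) h]; ring

/-- `(vert ε hε hε2).θ y = 0`. [folklore] -/
theorem vert_θ_of_le {y : ℝ} (h : y ≤ 13 / 10) : (vert ε hε hε2).θ y = 0 := by
  show π / 2 * stdBlend (13 / 10) (3 / 2) y = 0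
  rw [stdBlend_of_le (by norm_num) h]; ring

/-- `(vert ε hε hε2).θ y = π / 2`. [folklore] -/
theorem vert_θ_of_ge {y : ℝ} (h : 3 / 2 ≤ y) : (vert ε hε hε2).θ y = π / 2 := by
  show π / 2 * stdBlend (13 / 10) (3 / 2) y = π / 2
  rw [stdBlend_of_ge (by norm_num) h]; ring

/-- `(vert ε hε hε2).σ₁ y = 1`. [folklore] -/
theorem vert_σ₁_of_le {y : ℝ} (h : y ≤ 13 / 10) : (vert ε hε hε2).σ₁ y = 1 := by
  show 1 + (sig1top ε - 1) * stdBlend (13 / 10) (3 / 2) y = 1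
  rw [stdBlend_of_le (by norm_num) h]; ring

/-- `(vert ε hε hε2).σ₂ y = 1`. [folklore] -/
theorem vert_σ₂_of_le {y : ℝ} (h : y ≤ 13 / 10) : (vert ε hε hε2).σ₂ y = 1 := by
  show 1 + (sig2top ε - 1) * stdBlend (13 / 10) (3 / 2) y = 1
  rw [stdBlend_of_le (by norm_num) h]; ring

/-- `(vert ε hε hε2).σ₁ y = sig1top ε`. [folklore] -/
theorem vert_σ₁_of_ge {y : ℝ} (h : 3 / 2 ≤ y) : (vert ε hε hε2).σ₁ y = sig1top ε := by
  show 1 + (sig1top ε - 1) * stdBlend (13 / 10) (3 / 2) y = sig1top ε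
  rw [stdBlend_of_ge (by norm_num) h]; ring

/-- `(vert ε hε hε2).σ₂ y = sig2top ε`. [folklore] -/
theorem vert_σ₂_of_ge {y : ℝ} (h : 3 / 2 ≤ y) : (vert ε hε hε2).σ₂ y = sig2top ε := by
  show 1 + (sig2top ε - 1) * stdBlend (13 / 10) (3 / 2) y = sig2top ε
  rw [stdBlend_of_ge (by norm_num) h]; ring

end Vert

/-! ### The latitude thresholds `n₀(‖d‖) = ε ‖d‖ / √(1 + ‖d‖²)` -/

/-- `‖d‖ < 53/100 → n₀ < 47ε/100`. [folklore] -/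
theorem neg_capN_lt_of_norm_lt (hε : 0 < ε) {d : ℂ} (h : ‖d‖ < 53 / 100) : -capN ε d < 47 * ε / 100 := by
  rw [neg_capN_eq]
  have h1 := div_sqrt_one_add_sq_lt (r := ‖d‖) (c := 47 / 100) (by norm_num) (by nlinarith [norm_nonneg d])
  have h3 := mul_lt_mul_of_pos_left h1 hε
  rw [mul_div_assoc]
  linarith

/-- `62/100 < ‖d‖ → 52ε/100 < n₀`. [folklore] -/
theorem lt_neg_capN_of_lt_norm (hε : 0 < ε) {d : ℂ} (h : 62 / 100 < ‖d‖) : 52 * ε / 100 < -capN ε d := by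
  rw [neg_capN_eq]
  have hs : 0 < Real.sqrt (1 + ‖d‖ ^ 2) := Real.sqrt_pos.2 (by positivity)
  have h1 : 52 / 100 < ‖d‖ / Real.sqrt (1 + ‖d‖ ^ 2) := by
    rw [lt_div_iff₀ hs]
    have h2 : Real.sqrt (1 + ‖d‖ ^ 2) < ‖d‖ / (52 / 100) := by
      rw [Real.sqrt_lt' (by positivity)]
      nlinarith
    have := mul_lt_mul_of_pos_left h2 (by norm_num : (0:ℝ) < 52 / 100)
    rwa [mul_div_cancel₀ _ (by norm_num : (52 / 100 : ℝ) ≠ 0)] at this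
  have h3 := mul_lt_mul_of_pos_left h1 hε
  calc 52 * ε / 100 = ε * (52 / 100) := by ring
    _ < ε * (‖d‖ / Real.sqrt (1 + ‖d‖ ^ 2)) := h3
    _ = ε * ‖d‖ / Real.sqrt (1 + ‖d‖ ^ 2) := (mul_div_assoc _ _ _).symm

/-- `‖d‖ < 68/100 → n₀ < 113ε/200`. [folklore] -/
theorem neg_capN_lt_of_norm_lt' (hε : 0 < ε) {d : ℂ} (h : ‖d‖ < 68 / 100) : -capN ε d < 113 * ε / 200 := by
  rw [neg_capN_eq]
  have h1 := div_sqrt_one_add_sq_lt (r := ‖d‖) (c := 113 / 200) (by norm_num) (by nlinarith [norm_nonneg d])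
  have h3 := mul_lt_mul_of_pos_left h1 hε
  rw [mul_div_assoc]
  linarith

/-- `77/100 < ‖d‖ → 121ε/200 < n₀`. [folklore] -/
theorem lt_neg_capN_of_lt_norm' (hε : 0 < ε) {d : ℂ} (h : 77 / 100 < ‖d‖) : 121 * ε / 200 < -capN ε d := by
  rw [neg_capN_eq]
  have hs : 0 < Real.sqrt (1 + ‖d‖ ^ 2) := Real.sqrt_pos.2 (by positivity)
  have h1 : 121 / 200 < ‖d‖ / Real.sqrt (1 + ‖d‖ ^ 2) := by
    rw [lt_div_iff₀ hs]
    have h2 : Real.sqrt (1 + ‖d‖ ^ 2) < ‖d‖ / (121 / 200) := by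
      rw [Real.sqrt_lt' (by positivity)]
      nlinarith
    have := mul_lt_mul_of_pos_left h2 (by norm_num : (0:ℝ) < 121 / 200)
    rwa [mul_div_cancel₀ _ (by norm_num : (121 / 200 : ℝ) ≠ 0)] at this
  have h3 := mul_lt_mul_of_pos_left h1 hε
  calc 121 * ε / 200 = ε * (121 / 200) := by ring
    _ < ε * (‖d‖ / Real.sqrt (1 + ‖d‖ ^ 2)) := h3
    _ = ε * ‖d‖ / Real.sqrt (1 + ‖d‖ ^ 2) := (mul_div_assoc _ _ _).symm

/-- `n₀ < ε` always, and `n₀ ≤ ε ‖d‖`. [folklore] -/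
theorem neg_capN_lt_eps (hε : 0 < ε) (d : ℂ) : -capN ε d < ε := by
  rw [neg_capN_eq]
  have h1 : ‖d‖ / Real.sqrt (1 + ‖d‖ ^ 2) < 1 := by
    have hs : 0 < Real.sqrt (1 + ‖d‖ ^ 2) := Real.sqrt_pos.2 (by positivity)
    rw [div_lt_one hs, Real.lt_sqrt (norm_nonneg _)]
    nlinarith
  have h3 := mul_lt_mul_of_pos_left h1 hε
  rw [mul_div_assoc]
  linarith

end FP

end Literature.Topology.FourManifolds
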